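import Mathlib.Data.ZMod.Basic
import Mathlib.Tactic.IntervalCases
import Summits.MatrixMultiplication.OmegaCensus.IndepSetSearch

/-!
# ω-census, family (b3): centre of index `6` — the finite model of a coset fibre and its kernel certificate

HONEST FRAMING (pub-omega census; verbatim): lottery ticket; floor = certified bounds/negative ranges.
Census BOOKKEEPING (prereg P-028 of the cell, item .3): the machine half of a certified NEGATIVE RANGE for single TPP triples
with two `3`-sets in the groups with centre of index `6`; nothing here is progress on `ω`.  This file is group-free: it is used by
`CentreIndexSixTPP.lean`, where the reduction is proved.

THE MODEL.  Let `G = C₃ ⋊_ε C` (`C` abelian, `ε : C → {±1}`; exactly the groups with `[G : Z(G)] = 6` when `ε` is onto), with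
coordinates `g = c^{κ(g)} γ(g)`.  For a TPP triple `(S, T, U)` with `T = {1, t₁, t₂}`, `U = {1, u₁, u₂}` the cells `(x, y, w) ∈ S × T × U`
of one coset `x y w ∈ g·⟨c⟩` sit at `9` positions `p = (y, w)` with `3` lifts each, and (`CentreIndexSixTPP`, fibre word formula) two of
them interact — one of the two ordered TPP words `x x'⁻¹ (y y'⁻¹) (w w'⁻¹)` is trivial — iff their normalised lifts `λ, λ' : ZMod 3` satisfy
`λ − λ' = d(p, p')` or `λ' − λ = d(p', p)`, where `d(p, p') = −ε_{y'} ε_{w'} · (κ_y − ε_y ε_{y'} κ_{y'} + ε_y ε_{y'} (κ_w − ε_w ε_{w'} κ_{w'}))`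
depends only on the images ("labels") of `y, y', w, w'` in `G/Z(G) ≅ S₃`.  So a fibre is an independent set of a `27`-vertex graph determined
by the four labels of `t₁, t₂, u₁, u₂` (`6⁴ = 1296` configurations `n`; after sorting, `441`), and the claim "at most `5` cells per fibre"
is the finite statement `cert_all`: the tree's checker `IndepSearch.noIndep` refutes an independent `6`-set in every configuration
(`8 471` search nodes over the `441` sorted configurations, whose independence numbers are `3` (60×), `4` (210×), `5` (171×); the maximum
`5` is attained already in `S₃`, so `3|S||T||U| ≤ 5|G| = 3·Σ_χ χ(1)³` is the exact constant of the method).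
Encoding: a label `l < 6` has coordinate `l % 3` and sign bit `l / 3`; configuration `n` has `T`-labels `[0, n % 6, n / 6 % 6]` and
`U`-labels `[0, n / 36 % 6, n / 216 % 6]`; vertex `v = 3 p + λ`, `p = 3 i + j` the position `(tᵢ, uⱼ)`.  The adjacency matrix of a
configuration is packed into one natural once (`packAdj`), rows are read by shifting (`adjRow`).
-/

open Finset

namespace Summit.MatrixMultiplication.OmegaCensus.CentreIndexSix

open IndepSearch

/-! ## The model graph of a configuration -/

/-- `(−1)^s · a (mod 3)` on naturals. [folklore] -/
def ap (s a : ℕ) : ℕ := if s % 2 = 0 then a % 3 else (3 - a % 3) % 3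

/-- `B(p, p')` from the four labels `t, t', u, u'`. [folklore] -/
def Bn (lt lt' lu lu' : ℕ) : ℕ :=
  (lt % 3 + ap (lt / 3 + lt' / 3 + 1) (lt' % 3) + ap (lt / 3 + lt' / 3) (lu % 3 + ap (lu / 3 + lu' / 3 + 1) (lu' % 3))) % 3

/-- `d(p, p') = −ε_{t'} ε_{u'} B(p, p')`. [folklore] -/
def dn (lt lt' lu lu' : ℕ) : ℕ := ap (lt' / 3 + lu' / 3 + 1) (Bn lt lt' lu lu')

/-- `T`-labels of configuration `n`: `[0, n % 6, n / 6 % 6]`. [folklore] -/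
def labT (n i : ℕ) : ℕ := if i = 0 then 0 else if i = 1 then n % 6 else n / 6 % 6

/-- `U`-labels of configuration `n`: `[0, n / 36 % 6, n / 216 % 6]`. [folklore] -/
def labU (n j : ℕ) : ℕ := if j = 0 then 0 else if j = 1 then n / 36 % 6 else n / 216 % 6

/-- `d(p, p')` of configuration `n` for positions `p = 3 i + j`, `p' = 3 i' + j'`. [folklore] -/
def dpp (n p p' : ℕ) : ℕ := dn (labT n (p / 3)) (labT n (p' / 3)) (labU n (p % 3)) (labU n (p' % 3))

/-- Row of the vertex `3 p + l` restricted to the positions `< m`: bits `3 p' + λ'` with `λ' = l + 2 d(p,p')` or `λ' = l + d(p',p)`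
(`mod 3`), `p' ≠ p`. [folklore] -/
def rowAcc (n p l : ℕ) : ℕ → ℕ
  | 0 => 0
  | m + 1 => rowAcc n p l m |||
      (if m = p then 0 else 2 ^ (3 * m + (l + 2 * dpp n p m) % 3) ||| 2 ^ (3 * m + (l + dpp n m p) % 3))

/-- Adjacency row of the vertex `v = 3 p + λ` (a mask over the `27` vertices). [folklore] -/
def row (n v : ℕ) : ℕ := rowAcc n (v / 3) (v % 3) 9

/-- The first `m` rows packed into one natural (row `v` at bits `27 v … 27 v + 26`). [folklore] -/
def packRows (n : ℕ) : ℕ → ℕ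
  | 0 => 0
  | m + 1 => packRows n m ||| (row n m <<< (27 * m))

/-- The packed `27 × 27` adjacency matrix of configuration `n` (computed once per configuration by the kernel). [folklore] -/
def packAdj (n : ℕ) : ℕ := packRows n 27

/-- Row `v` of a packed matrix `A`. [folklore] -/
def adjRow (A v : ℕ) : ℕ := (A >>> (27 * v)) &&& (2 ^ 27 - 1)

/-- The vertex order used by the search (a permutation of `range 27`, tuned for the first-fit bound). [folklore] -/
def vsOrder : List ℕ := [24, 9, 1, 3, 23, 18, 15, 25, 13, 16, 7, 8, 2, 20, 12, 21, 26, 14, 5, 6, 4, 10, 11, 0, 22, 19, 17]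

/-- The certificate check of configuration `n`: `IndepSearch.noIndep` refutes an independent `6`-set. [folklore] -/
def certOK (n : ℕ) : Bool := noIndep (adjRow (packAdj n)) vsOrder (2 ^ 27 - 1) 6

/-- Sorted configurations (`T`-labels and `U`-labels non-decreasing): the reduction may order `t₁, t₂` and `u₁, u₂` freely, so only
these `21 × 21 = 441` configurations are searched. [folklore] -/
def sorted (n : ℕ) : Bool := decide (n % 6 ≤ n / 6 % 6) && decide (n / 36 % 6 ≤ n / 216 % 6)

/-! ### Semantics of the masks -/

/-- A set bit of `rowAcc` names a position `p' < m`, `p' ≠ p`, and one of the two joined lifts. [folklore] -/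
theorem testBit_rowAcc (n p l : ℕ) : ∀ (m b : ℕ), (rowAcc n p l m).testBit b = true →
    ∃ p' < m, p' ≠ p ∧ (b = 3 * p' + (l + 2 * dpp n p p') % 3 ∨ b = 3 * p' + (l + dpp n p' p) % 3)
  | 0, b, hb => by simp [rowAcc] at hb
  | m + 1, b, hb => by
      rw [rowAcc, Nat.testBit_lor, Bool.or_eq_true] at hb
      rcases hb with hb | hb
      · obtain ⟨p', hp', hne, h⟩ := testBit_rowAcc n p l m b hb
        exact ⟨p', by omega, hne, h⟩
      · split_ifs at hb with hmp
        · simp at hb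
        · rw [Nat.testBit_lor, Bool.or_eq_true, Nat.testBit_two_pow, Nat.testBit_two_pow] at hb
          simp only [decide_eq_true_eq] at hb
          exact ⟨m, by omega, hmp, by omega⟩

/-- A set bit `27 v + w` (`w < 27`) of `packRows n m` comes from row `v < m`. [folklore] -/
theorem testBit_packRows (n : ℕ) : ∀ (m v w : ℕ), w < 27 → (packRows n m).testBit (27 * v + w) = true →
    v < m ∧ (row n v).testBit w = true
  | 0, v, w, _, hb => by simp [packRows] at hb
  | m + 1, v, w, hw, hb => by
      rw [packRows, Nat.testBit_lor, Bool.or_eq_true] at hb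
      rcases hb with hb | hb
      · obtain ⟨hv, h⟩ := testBit_packRows n m v w hw hb
        exact ⟨by omega, h⟩
      · rw [Nat.testBit_shiftLeft, Bool.and_eq_true, decide_eq_true_eq] at hb
        obtain ⟨hge, hb⟩ := hb
        obtain ⟨p', hp', -, h⟩ := testBit_rowAcc n (m / 3) (m % 3) 9 _ hb
        have hlt : 27 * v + w - 27 * m < 27 := by omega
        have hvm : v = m := by omega
        subst hvm
        have : 27 * v + w - 27 * v = w := by omega
        rw [this] at hb
        exact ⟨by omega, hb⟩

/-- **Adjacency semantics.** A set bit `w` of row `v < 27` of `packAdj n`: `w < 27`, the positions differ, and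
`λ' ≡ λ + 2 d(p, p')` or `λ' ≡ λ + d(p', p)`. [folklore] -/
theorem adj_spec {n v w : ℕ} (h : (adjRow (packAdj n) v).testBit w = true) :
    w < 27 ∧ v / 3 ≠ w / 3 ∧
      (w % 3 = (v % 3 + 2 * dpp n (v / 3) (w / 3)) % 3 ∨ w % 3 = (v % 3 + dpp n (w / 3) (v / 3)) % 3) := by
  rw [adjRow, Nat.testBit_land, Bool.and_eq_true, Nat.testBit_shiftRight, Nat.testBit_two_pow_sub_one,
    decide_eq_true_eq] at h
  obtain ⟨hb, hw⟩ := h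
  obtain ⟨-, hr⟩ := testBit_packRows n 27 v w hw hb
  obtain ⟨p', -, hne, h⟩ := testBit_rowAcc n (v / 3) (v % 3) 9 w hr
  have hp : p' = w / 3 := by rcases h with h | h <;> omega
  subst hp
  refine ⟨hw, fun e => hne e.symm, ?_⟩
  rcases h with h | h
  · left; omega
  · right; omega

/-- Every vertex `< 27` is listed in `vsOrder` and lies in the full mask. [folklore] -/
theorem mem_vsOrder : ∀ a < 27, a ∈ vsOrder ∧ (2 ^ 27 - 1).testBit a = true := by decide

/-! ### The bridge to `ZMod 3` -/

/-- The `ZMod 3` coordinate of a label. [folklore] -/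
def kOf (l : ℕ) : ZMod 3 := ((l % 3 : ℕ) : ZMod 3)

/-- The sign of a label, as `±1 : ZMod 3`. [folklore] -/
def eOf (l : ℕ) : ZMod 3 := if l % 6 < 3 then 1 else -1

/-- `d(p, p')` read in `ZMod 3`: `−ε_{t'} ε_{u'} · B(p, p')` (checked on all `6⁴` label quadruples). [folklore] -/
theorem dn_cast : ∀ lt < 6, ∀ lt' < 6, ∀ lu < 6, ∀ lu' < 6, ((dn lt lt' lu lu' : ℕ) : ZMod 3) =
    -(eOf lt' * eOf lu') * (kOf lt - eOf lt * eOf lt' * kOf lt' + eOf lt * eOf lt' * (kOf lu - eOf lu * eOf lu' * kOf lu')) := by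
  decide +kernel

/-- `d(p, p') < 3`. [folklore] -/
theorem dn_lt (lt lt' lu lu' : ℕ) : dn lt lt' lu lu' < 3 := by
  unfold dn ap; split_ifs <;> omega


/-! ## The certificate (kernel search; `13` chunks, unsorted configurations are skipped) -/

/-- Chunk `0`. [folklore] -/
theorem cert_0 : ∀ r < 100, sorted (100 * 0 + r) = true → certOK (100 * 0 + r) = true := by decide +kernel
/-- Chunk `1`. [folklore] -/
theorem cert_1 : ∀ r < 100, sorted (100 * 1 + r) = true → certOK (100 * 1 + r) = true := by decide +kernel
/-- Chunk `2`. [folklore] -/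
theorem cert_2 : ∀ r < 100, sorted (100 * 2 + r) = true → certOK (100 * 2 + r) = true := by decide +kernel
/-- Chunk `3`. [folklore] -/
theorem cert_3 : ∀ r < 100, sorted (100 * 3 + r) = true → certOK (100 * 3 + r) = true := by decide +kernel
/-- Chunk `4`. [folklore] -/
theorem cert_4 : ∀ r < 100, sorted (100 * 4 + r) = true → certOK (100 * 4 + r) = true := by decide +kernel
/-- Chunk `5`. [folklore] -/
theorem cert_5 : ∀ r < 100, sorted (100 * 5 + r) = true → certOK (100 * 5 + r) = true := by decide +kernel
/-- Chunk `6`. [folklore] -/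
theorem cert_6 : ∀ r < 100, sorted (100 * 6 + r) = true → certOK (100 * 6 + r) = true := by decide +kernel
/-- Chunk `7`. [folklore] -/
theorem cert_7 : ∀ r < 100, sorted (100 * 7 + r) = true → certOK (100 * 7 + r) = true := by decide +kernel
/-- Chunk `8`. [folklore] -/
theorem cert_8 : ∀ r < 100, sorted (100 * 8 + r) = true → certOK (100 * 8 + r) = true := by decide +kernel
/-- Chunk `9`. [folklore] -/
theorem cert_9 : ∀ r < 100, sorted (100 * 9 + r) = true → certOK (100 * 9 + r) = true := by decide +kernel
/-- Chunk `10`. [folklore] -/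
theorem cert_10 : ∀ r < 100, sorted (100 * 10 + r) = true → certOK (100 * 10 + r) = true := by decide +kernel
/-- Chunk `11`. [folklore] -/
theorem cert_11 : ∀ r < 100, sorted (100 * 11 + r) = true → certOK (100 * 11 + r) = true := by decide +kernel
/-- Chunk `12`. [folklore] -/
theorem cert_12 : ∀ r < 100, sorted (100 * 12 + r) = true → certOK (100 * 12 + r) = true := by decide +kernel

/-- **Certificate.** In every sorted configuration the fibre graph has no independent `6`-set. [folklore] -/
theorem cert_all (n : ℕ) (hn : n < 1296) (hs : sorted n = true) : certOK n = true := by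
  have hq : n / 100 < 13 := by omega
  have hr : n % 100 < 100 := Nat.mod_lt _ (by omega)
  have e : n = 100 * (n / 100) + n % 100 := (Nat.div_add_mod n 100).symm
  rw [e] at hs ⊢
  generalize n / 100 = q at hq hs
  generalize n % 100 = r at hr hs
  interval_cases q
  exacts [cert_0 r hr hs, cert_1 r hr hs, cert_2 r hr hs, cert_3 r hr hs, cert_4 r hr hs, cert_5 r hr hs, cert_6 r hr hs,
    cert_7 r hr hs, cert_8 r hr hs, cert_9 r hr hs, cert_10 r hr hs, cert_11 r hr hs, cert_12 r hr hs]

/-- **Corollary used by the reduction.** An independent vertex set of a sorted configuration has at most `5` elements. [folklore] -/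
theorem indep_card_le_five {n : ℕ} (hn : n < 1296) (hs : sorted n = true) (I : Finset ℕ)
    (hI : IndepN (adjRow (packAdj n)) I) (hIn : ∀ a ∈ I, a < 27) : #I ≤ 5 := by
  have := card_lt_of_noIndep (adjRow (packAdj n)) vsOrder (2 ^ 27 - 1) 6 (cert_all n hn hs) I hI
    fun a ha => mem_vsOrder a (hIn a ha)
  omega

end Summit.MatrixMultiplication.OmegaCensus.CentreIndexSix
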